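import Summits.QuantumFields.YangMills.Theorems.ColdStartUniversalityUniformColdStartMixingFixedCutoffBlockLoopStringWindow
import Summits.QuantumFields.YangMills.Theorems.ColdStartUniversalityUniformColdStartMixingRungOfMixing
import Summits.QuantumFields.YangMills.Theorems.ColdStartUniversalityUniformColdStartMixingRung
import Summits.QuantumFields.YangMills.Theorems.ColdStartUniversalityLatticeLangevinPointwiseMixingExplicit
import Literature.MathematicalPhysics.QuantumFieldTheory.CentralCircleDominatedWilsonLoops
import HarnessLib

/-!
# Route `ColdStartUniversality`, aside K_A1 `UniformColdStartMixing` (24809): the RUNG'S CONCLUSION SHAPE (Cesàro mean in PHYSICAL time) for smooth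
# BLOCK-AVERAGED LOOP STRINGS at the cut-offs of the window `γε_K > 6`, with `T_c` INDEPENDENT of the number of sites `L_K³`

Helper file (seat `ym-line-csu-p1`, g28; `--supports stmt-QuantumFields-24809`).  g27's `fixedCutoffMixing_explicit_window` gives the rung
`stub_fixedCutoffMixing`'s Cesàro conclusion `|expectAt K os − T⁻¹∫₀ᵀ E[∏ avgObs(U(s/ε_K))] ds| ≤ δ` for `T ≥ ε_K(T_c + 4T_c/δ)` with `T_c = O(log L_K)`
(Pinsker).  For the SMOOTH block-averaged loop strings `∏_k W̄_(B,k)` (`W̄_(B,k) = (#B)⁻¹Σ_(x∈B) W_(R_k×T_k)(x; i_k, j_k)`, `½Re tr` Wilson loops) the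
transport–entropy bound (`coldStart_blockLoopString_fixedCutoff_window`) makes the threshold VOLUME-FREE:
* ★★★ `coldStart_blockLoopString_cesaro_fixedCutoff_window` — for `6 < γε_K` (`ρ_K = 1 − 6/(γε_K)`), every nonempty block `B`, every loop family with
  `Σ_k(R_k+T_k) > 0`, `δ > 0`, with `C_K = Σ_k(R_k+T_k)·√(32(366β'_K+3)(L_K³/#B)/ρ_K)` and `T_c = 2 + |log(2C_K/δ)|/ρ_K` (lattice units): for every
  solution of the SZZ dynamics at `β'_K` from any deterministic start and EVERY physical `T ≥ ε_K(T_c + 4T_c/δ)`,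
  `|∫ ∏_k W̄_(B,k) dμ_K − T⁻¹ ∫₀ᵀ E[∏_k W̄_(B,k)(U(s/ε_K))] ds| ≤ δ`.
With unit PHYSICAL blocks (`L_K³/#B = ℓ³`) `T_c` does not involve `L_K`.  Ingredients: the pointwise window bound, g8/g27's Cesàro bookkeeping
`abs_sub_inv_mul_integral_le_of_le`, `integrand_bound_and_intervalIntegrable`, `inv_mul_integral_comp_div`.  PLANNER-FACING, HONEST: only the COARSE
cut-offs `γε_K > 6`; smooth `½Re tr` block averages, not Bałaban's `avgObs expMeanLogSU` (so this is NOT the registered rung); nothing K-uniform;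
24809 ASIDE and NOT restated; no crux, rung or summit statement is proved; the Yang–Mills mass gap is NOT proved.  THEOREMS ONLY, no definition, no sorry.
[cite: ShenZhuZhu2022, §4 Theorem 4.2, Corollary 4.4]
-/

set_option autoImplicit false

noncomputable section

namespace Summit.QuantumFields.YangMills.Theorems.ColdStartUniversality

open MeasureTheory ProbabilityTheory Finset intervalIntegral
open scoped NNReal ENNReal BigOperators
open Literature.Probability.Process Literature.MathematicalPhysics.QuantumFieldTheory
open Literature.MathematicalPhysics.QuantumLattice (fundamentalRep fundamentalLatticeRep continuous_fundamentalRep)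
open Literature.MathematicalPhysics.QuantumFieldTheory.Balaban1983to89

/-- A block-averaged loop string is continuous and bounded by `1`. [folklore] -/
theorem continuous_and_abs_le_one_blockLoopString {L : ℕ} [NeZero L] (m : ℕ) (i j : Fin m → Fin 3) (R T : Fin m → ℕ)
    (B : Finset (Site 3 L)) (hB : B.Nonempty) :
    Continuous (fun V : GaugeConfig 3 L (Matrix.specialUnitaryGroup (Fin 2) ℂ) => (∏ k : Fin m, (((B.card : ℝ))⁻¹ * ∑ x ∈ B, wilsonLoop (fundamentalRep (Fin 2)) x (i k) (j k) (R k) (T k) V))) ∧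
      ∀ V : GaugeConfig 3 L (Matrix.specialUnitaryGroup (Fin 2) ℂ), |(∏ k : Fin m, (((B.card : ℝ))⁻¹ * ∑ x ∈ B, wilsonLoop (fundamentalRep (Fin 2)) x (i k) (j k) (R k) (T k) V))| ≤ 1 := by
  refine ⟨?_, ?_⟩
  · refine continuous_finsetProd _ fun k _ => continuous_const.mul (continuous_finsetSum _ fun x _ => ?_)
    exact continuous_wilsonLoop (fundamentalRep (Fin 2)) (continuous_fundamentalRep (Fin 2)) x (i k) (j k) (R k) (T k)
  · intro V
    rw [Finset.abs_prod]
    exact Finset.prod_le_one (fun k _ => abs_nonneg _) (fun k _ => abs_blockLoopAverage_le_one (i k) (j k) (R k) (T k) B hB V)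

/-- ★★★ **The rung's conclusion shape for smooth block-averaged loop strings at a window cut-off — Cesàro mean in physical time, `T_c` volume-free.**
For `6 < γε_K`, `ρ_K = 1 − 6/(γε_K)`, `C_K = Σ_k(R_k+T_k)√(32(366|β'_K|+3)(L_K³/#B)/ρ_K)`, `T_c = 2 + |log(2C_K/δ)|/ρ_K`: for every solution at `β'_K` from a
deterministic start and every physical `T ≥ ε_K·(T_c + 4T_c/δ)`,
`|∫ ∏_k W̄_(B,k) dμ_K − T⁻¹ ∫₀ᵀ E[∏_k W̄_(B,k)(U(s/ε_K))] ds| ≤ δ`. [cite: ShenZhuZhu2022, §4 Theorem 4.2, Corollary 4.4] -/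
theorem coldStart_blockLoopString_cesaro_fixedCutoff_window (F : T3ContinuumYM3Torus.T3Family) (γ : ℝ) (K : ℕ) (hK : 6 < γ * (F.P K).eps)
    (B : Finset (Site 3 ((F.P K).sitesPerDir 0))) (hB : B.Nonempty) (m : ℕ) (i j : Fin m → Fin 3) (R T : Fin m → ℕ) (hRT : 0 < ∑ k, (R k + T k))
    (z : GaugeConfig 3 ((F.P K).sitesPerDir 0) (Matrix.specialUnitaryGroup (Fin 2) ℂ))
    {Ω : Type} [MeasurableSpace Ω] {P : Measure Ω} [IsProbabilityMeasure P]
    {W : ℝ≥0 → Ω → (Edge 3 ((F.P K).sitesPerDir 0) × NoiseIdx 2 → ℝ)} (hW : IsFlatBrownian W P)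
    {U : ℝ≥0 → Ω → GaugeConfig 3 ((F.P K).sitesPerDir 0) (Matrix.specialUnitaryGroup (Fin 2) ℂ)} (hU0 : ∀ ω, U 0 ω = z)
    (hU : (latticeLangevinDynamics (fundamentalLatticeRep 2) ((γ * (F.P K).eps)⁻¹ / 2)).IsSolution (fundamentalRep (Fin 2)) hW.natFiltration P W U)
    {δ : ℝ} (hδ : 0 < δ) {Tphys : ℝ}
    (hT : (F.P K).eps * ((2 + |Real.log (2 * ((∑ k : Fin m, ((R k : ℝ) + T k)) * Real.sqrt (32 * (366 * |((γ * (F.P K).eps)⁻¹ / 2)| + 3) * ((((((F.P K).sitesPerDir 0) : ℕ) : ℝ)) ^ 3 / (B.card : ℝ)) / (1 - 6 / (γ * (F.P K).eps)))) / δ)| / (1 - 6 / (γ * (F.P K).eps))) + 4 * (2 + |Real.log (2 * ((∑ k : Fin m, ((R k : ℝ) + T k)) * Real.sqrt (32 * (366 * |((γ * (F.P K).eps)⁻¹ / 2)| + 3) * ((((((F.P K).sitesPerDir 0) : ℕ) : ℝ)) ^ 3 / (B.card : ℝ)) / (1 - 6 / (γ * (F.P K).eps)))) / δ)| / (1 -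 6 / (γ * (F.P K).eps))) / δ) ≤ Tphys) :
    |(∫ V, (∏ k : Fin m, (((B.card : ℝ))⁻¹ * ∑ x ∈ B, wilsonLoop (fundamentalRep (Fin 2)) x (i k) (j k) (R k) (T k) V)) ∂(wilsonMeasure (d := 3) (L := ((F.P K).sitesPerDir 0)) (fundamentalRep (Fin 2)) ((γ * (F.P K).eps)⁻¹ / 2))) -
        Tphys⁻¹ * ∫ s in (0 : ℝ)..Tphys, (∫ ω, (∏ k : Fin m, (((B.card : ℝ))⁻¹ * ∑ x ∈ B, wilsonLoop (fundamentalRep (Fin 2)) x (i k) (j k) (R k) (T k) (U (s / (F.P K).eps).toNNReal ω))) ∂P)| ≤ δ := by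
  classical
  have he : 0 < (F.P K).eps := (F.P K).eps_pos
  have hγε : 0 < γ * (F.P K).eps := lt_trans (by norm_num) hK
  have hρ : 0 < (1 - 6 / (γ * (F.P K).eps)) := by rw [sub_pos, div_lt_one hγε]; exact hK
  haveI := secondCountableTopology_su2
  haveI := borelSpace_config ((F.P K).sitesPerDir 0)
  haveI : IsProbabilityMeasure (wilsonMeasure (d := 3) (L := ((F.P K).sitesPerDir 0)) (fundamentalRep (Fin 2)) ((γ * (F.P K).eps)⁻¹ / 2)) :=
    isProbabilityMeasure_wilsonMeasure (d := 3) (L := ((F.P K).sitesPerDir 0)) (fundamentalRep (Fin 2)) (continuous_fundamentalRep (Fin 2)) _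
  obtain ⟨hcont, hbd⟩ := continuous_and_abs_le_one_blockLoopString m i j R T B hB
  -- the lattice-time integrand
  set g : ℝ → ℝ := fun t => ∫ ω, (∏ k : Fin m, (((B.card : ℝ))⁻¹ * ∑ x ∈ B, wilsonLoop (fundamentalRep (Fin 2)) x (i k) (j k) (R k) (T k) (U t.toNNReal ω))) ∂P with hg
  obtain ⟨hgb, hgi⟩ := integrand_bound_and_intervalIntegrable hW hU hcont.measurable hbd
  set e : ℝ := ∫ V, (∏ k : Fin m, (((B.card : ℝ))⁻¹ * ∑ x ∈ B, wilsonLoop (fundamentalRep (Fin 2)) x (i k) (j k) (R k) (T k) V)) ∂(wilsonMeasure (d := 3) (L := ((F.P K).sitesPerDir 0)) (fundamentalRep (Fin 2)) ((γ * (F.P K).eps)⁻¹ / 2)) with hedef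
  have he1 : |e| ≤ 1 := by
    have h := norm_integral_le_of_norm_le_const (μ := (wilsonMeasure (d := 3) (L := ((F.P K).sitesPerDir 0)) (fundamentalRep (Fin 2)) ((γ * (F.P K).eps)⁻¹ / 2))) (ae_of_all _ fun V => (show ‖(∏ k : Fin m, (((B.card : ℝ))⁻¹ * ∑ x ∈ B, wilsonLoop (fundamentalRep (Fin 2)) x (i k) (j k) (R k) (T k) V))‖ ≤ 1 by rw [Real.norm_eq_abs]; exact hbd V))
    rw [Real.norm_eq_abs, probReal_univ, mul_one] at h
    exact h
  obtain ⟨C, hC⟩ : ∃ C : ℝ, ((∑ k : Fin m, ((R k : ℝ) + T k)) * Real.sqrt (32 * (366 * |((γ * (F.P K).eps)⁻¹ / 2)| + 3) * ((((((F.P K).sitesPerDir 0) : ℕ) : ℝ)) ^ 3 / (B.card : ℝ)) / (1 - 6 / (γ * (F.P K).eps)))) = C := ⟨_, rfl⟩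
  set Tc : ℝ := (2 + |Real.log (2 * ((∑ k : Fin m, ((R k : ℝ) + T k)) * Real.sqrt (32 * (366 * |((γ * (F.P K).eps)⁻¹ / 2)| + 3) * ((((((F.P K).sitesPerDir 0) : ℕ) : ℝ)) ^ 3 / (B.card : ℝ)) / (1 - 6 / (γ * (F.P K).eps)))) / δ)| / (1 - 6 / (γ * (F.P K).eps))) with hTc
  rw [hC] at hTc
  have hTc2 : 2 ≤ Tc := by rw [hTc]; linarith [div_nonneg (abs_nonneg (Real.log (2 * C / δ))) hρ.le]
  have hTcpos : 0 < Tc := by linarith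
  -- pointwise mixing after `T_c`
  have hmix : ∀ t : ℝ, Tc ≤ t → |e - g t| ≤ δ / 2 := by
    intro t ht
    have ht2 : 2 ≤ t := hTc2.trans ht
    have hpt := coldStart_blockLoopString_fixedCutoff_window F γ K hK B hB m i j R T hRT z hW hU0 hU (t - 2).toNNReal
    rw [two_add_toNNReal_sub_two ht2, hC] at hpt
    have hS : (0 : ℝ) < (B.card : ℝ) := by exact_mod_cast hB.card_pos
    have hRT' : (0 : ℝ) < (∑ k : Fin m, ((R k : ℝ) + T k)) := by
      have h' : ((∑ k, (R k + T k) : ℕ) : ℝ) = (∑ k : Fin m, ((R k : ℝ) + T k)) := by push_cast; rfl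
      rw [← h']; exact_mod_cast hRT
    have hLpos : (0 : ℝ) < (((((F.P K).sitesPerDir 0) : ℕ) : ℝ)) ^ 3 := by
      have : 0 < ((F.P K).sitesPerDir 0) := Nat.pos_of_ne_zero (NeZero.ne _)
      positivity
    have hCpos : 0 < C := by
      rw [← hC]
      refine mul_pos hRT' (Real.sqrt_pos.2 ?_)
      refine div_pos (mul_pos (mul_pos (by norm_num) ?_) (div_pos hLpos hS)) hρ
      positivity
    -- `e^(−ρ (t−2)) C ≤ δ/2`
    have hu : Real.log (2 * C / δ) ≤ (1 - 6 / (γ * (F.P K).eps)) * (t - 2) := by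
      have h1 : |Real.log (2 * C / δ)| / (1 - 6 / (γ * (F.P K).eps)) ≤ t - 2 := by rw [hTc] at ht; linarith
      rw [div_le_iff₀ hρ] at h1
      linarith [le_abs_self (Real.log (2 * C / δ))]
    have hexp : Real.exp (-(1 - 6 / (γ * (F.P K).eps)) * (((t - 2).toNNReal : ℝ≥0) : ℝ)) ≤ δ / (2 * C) := by
      rw [Real.coe_toNNReal _ (by linarith)]
      have h1 : Real.exp (-(1 - 6 / (γ * (F.P K).eps)) * (t - 2)) ≤ Real.exp (-Real.log (2 * C / δ)) := Real.exp_le_exp.2 (by linarith)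
      rw [Real.exp_neg (Real.log (2 * C / δ)), Real.exp_log (by positivity), inv_div] at h1
      exact h1
    have hfin : Real.exp (-(1 - 6 / (γ * (F.P K).eps)) * (((t - 2).toNNReal : ℝ≥0) : ℝ)) * C ≤ δ / 2 := by
      calc Real.exp (-(1 - 6 / (γ * (F.P K).eps)) * (((t - 2).toNNReal : ℝ≥0) : ℝ)) * C ≤ δ / (2 * C) * C := mul_le_mul_of_nonneg_right hexp hCpos.le
        _ = δ / 2 := by field_simp
    rw [abs_sub_comm]
    exact hpt.trans hfin
  -- Cesàro in lattice time, then the physical time change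
  have hTphys : 0 < Tphys := lt_of_lt_of_le (by positivity) hT
  set T' : ℝ := Tphys / (F.P K).eps with hT'
  have hT'ge : Tc + 4 * Tc / δ ≤ T' := by
    rw [hT', le_div_iff₀ he]; linarith
  have hlat := abs_sub_inv_mul_integral_le_of_le hTcpos hδ le_rfl he1 hgb hgi hmix hT'ge
  have hT'ne : T' ≠ 0 := by
    have : 0 < T' := lt_of_lt_of_le hTcpos (le_trans (le_add_of_nonneg_right (by positivity)) hT'ge)
    exact this.ne'
  have hchange := inv_mul_integral_comp_div g he.ne' hT'ne
  have eT : (F.P K).eps * T' = Tphys := by rw [hT']; field_simp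
  rw [eT] at hchange
  rw [hchange]
  exact hlat

end Summit.QuantumFields.YangMills.Theorems.ColdStartUniversality
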